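import Mathlib
import HarnessLib
import Summits.Schanuel.Schanuel.Theses.DiophantineDichotomy
import Literature.Barriers.Schanuel.NesterenkoModularScope

/-!
# Sketch — crux-ideate stmt-Schanuel-6118 (`DiophantineDichotomy.EPiSimultaneousType`), round 1, ideator 2

First lemmas of the two idea cards `gamma-half-stokes` and `tate-nome-inv-e`, plus the two shared
reductions (height-dominant regime; codimension-one transfer at (π, e)).  Everything here is a `def … : Prop`
(statement shapes over existing declarations) or a small proved sanity lemma; nothing is an item.
-/

noncomputable section

set_option linter.dupNamespace false

open Complex
open Summit.Schanuel.Schanuel.Theses.DiophantineDichotomy (EPiSimultaneousType)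

namespace Summit.Schanuel.Schanuel.Cruxes.EPiSimultaneousType.Ideate2

/-! ### Currency: measures of algebraic independence in separated (degree, log-height) form -/

/-- Naive height of an integer multivariate polynomial (max `|coeff|`, `0` for the zero polynomial). -/
def mvHeight {σ : Type*} (P : MvPolynomial σ ℤ) : ℕ :=
  P.support.sup fun m => (P.coeff m).natAbs

/-- Codimension-one measure at a real point `θ ∈ ℝⁿ` with degree exponent `k` and penalty exponent `k'`:
`|P(θ)| ≥ exp(−c((deg P + 1)^k · log(H(P) + 1) + (deg P + 1)^{k'}))` for every non-zero `P ∈ ℤ[X₁..Xₙ]`.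
(Box principle forces `k ≥ n`; at `n = 2` the crux needs `k < 3`, see `CodimOneTransferEPi`.) -/
def MeasAlgIndep {n : ℕ} (θ : Fin n → ℝ) (k k' : ℝ) : Prop :=
  ∃ c : ℝ, 0 < c ∧ ∀ P : MvPolynomial (Fin n) ℤ, P ≠ 0 →
    Real.exp (-(c * (((P.totalDegree : ℝ) + 1) ^ k * Real.log ((mvHeight P : ℝ) + 1)
      + ((P.totalDegree : ℝ) + 1) ^ k'))) ≤ |MvPolynomial.aeval θ P|

/-! ### Shared reduction 1: only the height-dominant regime `log H ≥ d^B` is live -/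

/-- The crux restricted to challengers of super-polynomially large height, `log H ≥ d^B`. -/
def EPiLargeHeight (B : ℝ) : Prop :=
  ∃ a b C : ℝ, a < 1 ∧ 0 < C ∧ ∀ (d H : ℕ) (γ : Fin 2 → ℂ), (d : ℝ) ^ B ≤ Real.log H →
    Module.finrank ℚ ↥(IntermediateField.adjoin ℚ (Set.range γ)) ≤ d →
    (∀ i, ∃ P : Polynomial ℤ, P ≠ 0 ∧ P.natDegree ≤ d ∧ (∀ k, |P.coeff k| ≤ (H : ℤ)) ∧
      Polynomial.aeval (γ i) P = 0) →
    Real.exp (-(C * ((d : ℝ) ^ a * Real.log H + (d : ℝ) ^ b))) ≤ ‖γ - ![(Real.pi : ℂ), (Real.exp 1 : ℂ)]‖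

/-- Shape of the printed approximation measure of `π` (Nesterenko–Waldschmidt 1996, Thm 2(1), Fel'dman):
`|π − ξ| ≥ exp(−c·d(log H + d log d)(1 + log d))` for algebraic `ξ` of degree `≤ d`, height `≤ H`
(to be vendored as a Literature named fact; complex `ξ` via the Main Theorem with `θ = πi`, `β = iξ`). -/
def PiApproxMeasure : Prop :=
  ∃ c : ℝ, 0 < c ∧ ∀ (d H : ℕ) (ξ : ℂ), 1 ≤ d → 3 ≤ H →
    (∃ P : Polynomial ℤ, P ≠ 0 ∧ P.natDegree ≤ d ∧ (∀ k, |P.coeff k| ≤ (H : ℤ)) ∧ Polynomial.aeval ξ P = 0) →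
    Real.exp (-(c * d * (Real.log H + d * Real.log d) * (1 + Real.log d))) ≤ ‖ξ - (Real.pi : ℂ)‖

/-- Height-dominant reduction (provable now, M-sized): below `log H = d^B` the single-variable measure of `π`
already gives `exp(−C' d^{B+2+ε})`, absorbed by the free `d^b` term; so the crux is equivalent to its
restriction to `log H ≥ d^B` for any fixed `B`. -/
def HeightDominantReduction : Prop :=
  PiApproxMeasure → ∀ B : ℝ, 0 ≤ B → EPiLargeHeight B → EPiSimultaneousType

/-! ### Shared reduction 2: codimension-one transfer at (π, e) (Siegel inside the challenger's ideal) -/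

/-- A codimension-one measure at `(π, e)` with degree exponent `k < 3` gives the crux with `a = (k − 1)/2`:
the challenger `γ` of degree `d`, height `H` has a non-zero `P ∈ ℤ[x, y]` of degree `≍ √d` and log-height
`≲ (log H)/√d` vanishing at it (relative Siegel lemma, no discriminant), and `|P(π,e)| ≤ ‖∇P‖·‖γ − (π,e)‖`.
(Instance at `(π, e)` of the sibling crux's `stub_codimOneTransfer`; provable now.) -/
def CodimOneTransferEPi : Prop :=
  ∀ k k' : ℝ, 2 ≤ k → k < 3 → MeasAlgIndep ![Real.pi, Real.exp 1] k k' → EPiSimultaneousType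

/-! ### Card `gamma-half-stokes`: `√π = F(1) + Э(1)/e` — E/Э splitting of `Γ(1/2)` at the algebraic abscissa 1 -/

/-- `F(1) = Σ_{n≥0} (−1)ⁿ/(n!(n + ½)) = ∫₀¹ e^{−t} t^{−1/2} dt = √π·erf 1` — the value at `z = 1` of the
E-function `F(z) = Σ (−z)ⁿ/(n!(n+½))` (rational coefficients, `zF′ + F/2 = e^{−z}`). -/
def erfHalfE : ℝ := ∑' n : ℕ, (-1 : ℝ) ^ n / ((n.factorial : ℝ) * ((n : ℝ) + 1 / 2))

/-- `Э(1) = ∫₀^∞ e^{−u}(1 + u)^{−1/2} du = e·Γ(½, 1) = e√π·erfc 1` — the Borel–Laplace sum at `z = 1`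
(direction `ℝ₊`) of the Э-series `Σ (−1)ⁿ(½)ₙ zⁿ⁺¹` (Fischler–Rivoal's ring **D**). -/
def stokesHalfAntiE : ℝ := ∫ u in Set.Ioi (0 : ℝ), Real.exp (-u) * (1 + u) ^ (-(1 / 2 : ℝ))

/-- FIRST LEMMA of `gamma-half-stokes` (provable now; checked numerically to 1e-13 in this session):
`Γ(1/2) = ∫₀¹ + ∫₁^∞` at the algebraic abscissa `t = 1` reads `√π = F(1) + Э(1)/e`. -/
def GammaHalfSplitting : Prop :=
  Real.sqrt Real.pi = erfHalfE + stokesHalfAntiE / Real.exp 1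

/-- The pair `(Ψ(1), e)` where `Ψ(1) = F(1) + Э(1)/e` is the value at `z = 1` of the exponentially-mixed
function `Ψ(z) = √z·F̃(z) + e^{−z} z^{−1/2} Э̃(1/z) ≡ Γ(1/2)` (a ℂ-constant = connection/Stokes constant of the
module): a codimension-one measure for THIS pair in separated currency.  By `GammaHalfSplitting` it is literally
the measure at `(√π, e)`; box principle allows any `k ≥ 2` (two numbers), so `k < 3` is NOT vacuous here
(a measure for the TRIPLE `(e, F(1), Э(1))` would force `k ≥ 3` and could not feed the crux — recorded dead). -/
def StokesPairMeasure (k k' : ℝ) : Prop :=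
  MeasAlgIndep ![erfHalfE + stokesHalfAntiE / Real.exp 1, Real.exp 1] k k'

/-- Transfer of `gamma-half-stokes` (provable now from `GammaHalfSplitting`): `P(π, e) = P̃(√π, e)` with
`P̃(s, y) := P(s², y)`, `deg P̃ ≤ 2 deg P`, same height, `P ≠ 0 → P̃ ≠ 0`; exponents are kept. -/
def StokesTransfer : Prop :=
  ∀ k k' : ℝ, 0 ≤ k → 0 ≤ k' → GammaHalfSplitting → StokesPairMeasure k k' →
    MeasAlgIndep ![Real.pi, Real.exp 1] k k'

/-- What ANY engine must output at `(π, e)` (Philippon's criterion input, NP2001 Ch. 3 Thm 2.1, in the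
two-variable case): an auxiliary sequence `A_N ∈ ℤ[x, y]` of size `≤ τ(N)` with
`exp(−γ₂λ(N)) ≤ |A_N(π, e)| ≤ exp(−γ₁λ(N))`, `λ(N+1)/λ(N) → 1`, `λ/τ^{k+1} → ∞`.  With `k = 1` it already
yields `trdeg ℚ(π, e) = 2`; no such sequence is known (products of one-variable sequences have `λ = O(τ²)`). -/
def AuxSequenceEPi (k : ℕ) : Prop :=
  ∃ (τ lam : ℕ → ℝ) (A : ℕ → MvPolynomial (Fin 2) ℤ) (γ₁ γ₂ : ℝ), 0 < γ₁ ∧ γ₁ < γ₂ ∧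
    Filter.Tendsto τ Filter.atTop Filter.atTop ∧
    Filter.Tendsto (fun N => lam (N + 1) / lam N) Filter.atTop (nhds 1) ∧
    Filter.Tendsto (fun N => lam N / τ N ^ (k + 1)) Filter.atTop Filter.atTop ∧
    ∀ᶠ N in Filter.atTop, ((A N).totalDegree : ℝ) ≤ τ N ∧ Real.log ((mvHeight (A N) : ℝ) + 1) ≤ τ N ∧
      Real.exp (-(γ₂ * lam N)) ≤ |MvPolynomial.aeval ![Real.pi, Real.exp 1] (A N)| ∧
      |MvPolynomial.aeval ![Real.pi, Real.exp 1] (A N)| ≤ Real.exp (-(γ₁ * lam N))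

/-- The whole `gamma-half-stokes` line as one implication (its only open input is `StokesPairMeasure k k'`
for some `2 ≤ k < 3`, i.e. a Shidlovskii-type measure for the two transcendental values at `z = 1` of the
rank-4 arithmetic-Gevrey module `⟨1, e^z, √z F̃(z), e^{−z}z^{−1/2}Э̃(1/z)⟩`; its qualitative shadow is `e ⊥ π`). -/
def GammaHalfStokesLine : Prop :=
  (∃ k k' : ℝ, 2 ≤ k ∧ k < 3 ∧ 0 ≤ k' ∧ StokesPairMeasure k k') → EPiSimultaneousType

theorem gammaHalfStokesLine_of (hsplit : GammaHalfSplitting) (htr : StokesTransfer)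
    (hcod : CodimOneTransferEPi) : GammaHalfStokesLine := by
  rintro ⟨k, k', hk2, hk3, hk', hM⟩
  exact hcod k k' hk2 hk3 (htr k k' (by linarith) hk' hsplit hM)

/-! ### Card `tate-nome-inv-e`: the Tate curve `ℂ^×/e^ℤ` — periods `{1, 2πi}`, invariants in `ℚ[[1/e]]` -/

open Literature.Barriers.Schanuel in
/-- The Nesterenko point at the Tate nome `q = 1/e = e^{2πiτ}`, `τ = i/(2π)`:
`ω_e = (e^{−1}, P(e^{−1}), Q(e^{−1}), R(e^{−1}))`. -/
def tateNomePoint : Fin 4 → ℂ :=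
  ![cexp (-1), ramanujanP (cexp (-1)), ramanujanQ (cexp (-1)), ramanujanR (cexp (-1))]

open Literature.Barriers.Schanuel in
/-- Nesterenko's Theorem 1.1 at the Tate nome (specialisation of the tree's named fact, proved here):
`trdeg ℚ(e^{−1}, P(e^{−1}), Q(e^{−1}), R(e^{−1})) ≥ 3`. -/
theorem nesterenko_at_inv_e (h : nesterenko1996_thm_1_1) :
    (3 : Cardinal) ≤ Algebra.trdeg ℚ
      (IntermediateField.adjoin ℚ ({cexp (-1), ramanujanP (cexp (-1)), ramanujanQ (cexp (-1)),
        ramanujanR (cexp (-1))} : Set ℂ)) := by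
  refine h (cexp (-1)) ?_ ?_
  · rw [Complex.norm_exp]; exact Real.exp_pos _
  · rw [Complex.norm_exp]
    have : ((-1 : ℂ)).re = -1 := by simp
    rw [this]
    exact Real.exp_lt_one_iff.mpr (by norm_num)

open Literature.Barriers.Schanuel in
/-- FIRST LEMMA of `tate-nome-inv-e` (provable now; checked numerically in this session for the homothetic
lattice `ℤ + πiℤ`, `q = e^{−2}`): the weight-4 Eisenstein series of the Tate lattice `Λ_e = ℤ + 2πiℤ` is
π-free, `G₄(Λ_e) = Σ'(m + 2πin)^{−4} = Q(e^{−1})/720` (because `G₄(ℤω₁+ℤω₂) = ω₁^{−4}·2ζ(4)E₄(τ)` with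
`ω₁ = 2πi`, `2ζ(4) = π⁴/45`); likewise `G₆(Λ_e) = −R(e^{−1})/(216·140)·…`, so
`E_e : y² = 4x³ − (Q(e⁻¹)/12)x + R(e⁻¹)/216` has period lattice exactly `ℤ·1 + ℤ·2πi`. -/
def TateLatticeG4 : Prop :=
  (∑' p : ℤ × ℤ, if p = 0 then (0 : ℂ) else (((p.1 : ℂ) + 2 * Real.pi * I * p.2) ^ 4)⁻¹)
    = ramanujanQ (cexp (-1)) / 720

/-- C⁺ of `tate-nome-inv-e` is the SAME polynomial-currency statement at `(π, e)` as for every line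
(`MeasAlgIndep ![π, e] k k'`, `2 ≤ k < 3`): a relative measure of `π` over the whole Nesterenko field
`ℤ[e⁻¹, P, Q, R](1/e)` cannot feed the crux (box principle in 5 variables forces degree exponent `≥ 5`; recorded
dead in the card).  What the Tate dictionary changes is the ENGINE asked to produce `AuxSequenceEPi`: Nesterenko's
`(q d/dq)`-construction at the nome `q = 1/e` (known output: `nesterenko_at_inv_e`) coupled with Schneider's
`d/dz`-construction on `E_e = ℂ^×/e^ℤ`, whose torsion-coset values `(℘(m + 2πik/N), e^{m + 2πik/N}) =
(x(N-torsion), e^m ζ_N^k)` lie in `ℚ(e, ζ_N, Q(e⁻¹), R(e⁻¹), E_e[N])` for ALL `m ∈ ℤ`. -/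
def TateNomeLine : Prop :=
  (∃ k k' : ℝ, 2 ≤ k ∧ k < 3 ∧ MeasAlgIndep ![Real.pi, Real.exp 1] k k') → EPiSimultaneousType

theorem tateNomeLine_of (hcod : CodimOneTransferEPi) : TateNomeLine := by
  rintro ⟨k, k', hk2, hk3, hM⟩
  exact hcod k k' hk2 hk3 hM

end Summit.Schanuel.Schanuel.Cruxes.EPiSimultaneousType.Ideate2
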